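import Summits.Ventures.YMGap.RobustBall.SummableOneLink
import Summits.Ventures.YMGap.RobustBall.RobustOneLink
import Literature.Probability.LatticeModels.DobrushinMetricInfiniteRange
import HarnessLib

/-!
# Venture YMGap, track ROBUST-BALL (tier 2) — the robust Dobrushin door for SUMMABLE link potentials on `ℤ^d`

HONEST FRAMING. WHAT THIS IS: a venture file (cell `pub-ymgap`, track Y2 ROBUST-BALL, seat rb-p1): the
TIER-2 DOOR on `ℤ^d`. For the perturbed `SU(N)` specification `perturbedYMS (fundamentalRep (Fin N)) (N β) W`
of a link potential with a summable majorant (`IsLinkSummable W B`, `SummableSpecification.lean`) —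
infinitely many terms through every link allowed — it proves Dobrushin's condition in the
Vasserstein form with SUMMABLE rows (Föllmer 1988, Ch. I (2.20)): the SITEWISE influence of the link
`y` on the law at `e` is `C(e, y) = e^{a} √(c v) |β| n(e, y) + e^{a/2} √c ℓ(e, y)`
(`abs_integral_siteLaw_perturbedYMS_sub_le`), where `ℓ(e, y) ≥ ∑'_{X ∋ e, y} lip X y` is the (now
infinite) cross-Lipschitz coefficient, from the robust one-link lemma (`RobustOneLink.lean`) exactly
as in tier 1 (`SummableOneLink.lean` supplies the oscillation window and the cross influence of the
series `V_ω = ∑'_{X ∋ e} W_X`); QUASILOCALITY of the one-link law (`siteLaw_perturbedYMS_quasilocal`: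
equal drifts once the boundary conditions agree on the plaquette neighbours, and the majorant tail)
upgrades the sitewise bound to the GLOBAL summable bound for all pairs of boundary conditions
(`abs_integral_siteLaw_perturbedYMS_sub_le_tsum`, lit-1's `global_of_sitewise_of_quasilocal`) — the
hypothesis `hcontr` of lit-1's infinite-range uniqueness and decay theorems, consumed by
`SummableMassGap.lean`. The Poincaré (`c`) and linear-variance (`v`) inputs on the ball
`‖B‖_op ≤ b ⊇ 2(d-1)|β|` are the hypotheses `hP`, `hVB` of tier 1, verbatim. WHAT THIS IS NOT: no
number; a lattice strong-coupling statement; no continuum / Millennium claim.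

## References

* H. Föllmer, LNM 1362 (1988), Ch. I, (2.4), (2.20).
* S. Friedli, Y. Velenik, *Statistical Mechanics of Lattice Systems* (2017), Thm. 6.31 (quasilocal `π`).
-/

noncomputable section

open MeasureTheory Filter Function ProbabilityTheory Real Topology
open scoped NNReal
open Literature.Probability.LatticeModels
open Literature.Probability.LatticeModels.DobrushinMetric
open Literature.MathematicalPhysics.QuantumLattice
open Literature.MathematicalPhysics.QuantumFieldTheory hiding ZdEdge

namespace Summit.Ventures.YMGap.RobustBall

variable {d N : ℕ}

/-! ### `SU(N)`: the sitewise contraction, quasilocality, the global summable bound -/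

section SUN

variable {W : Potential (ZdEdge d) (Matrix.specialUnitaryGroup (Fin N) ℂ)} {B : Finset (ZdEdge d) → ℝ}

/-- The 't Hooft one-link drift `N Re tr(g B_ω)` reads the boundary condition only on `linkPlaqNbr e`
(locality of the one-link Wilson action, `isCylinder_wilsonBoundaryAction_holds`, and
`thooft_wilsonBoundaryAction_update`). -/
theorem re_trace_mul_stapleField_congr (β : ℝ) (e : ZdEdge d)
    {ω η : LGConfig d (Matrix.specialUnitaryGroup (Fin N) ℂ)} (h : ∀ z ∈ linkPlaqNbr e, ω z = η z)
    (g : Matrix.specialUnitaryGroup (Fin N) ℂ) :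
    (N : ℝ) * ((g : Matrix (Fin N) (Fin N) ℂ) * stapleField β e ω).trace.re =
      (N : ℝ) * ((g : Matrix (Fin N) (Fin N) ℂ) * stapleField β e η).trace.re := by
  have hS : wilsonBoundaryAction (fundamentalRep (Fin N)) {e} (Function.update ω e g) =
      wilsonBoundaryAction (fundamentalRep (Fin N)) {e} (Function.update η e g) := by
    refine isCylinder_wilsonBoundaryAction_holds (fundamentalRep (Fin N)) {e} fun z hz => ?_
    by_cases hze : z = e
    · subst hze; simp
    · rw [Function.update_of_ne hze, Function.update_of_ne hze]
      exact h z (Finset.mem_erase.2 ⟨hze, hz⟩)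
  have h1 := thooft_wilsonBoundaryAction_update β e ω g
  have h2 := thooft_wilsonBoundaryAction_update β e η g
  rw [hS] at h1
  linarith

/-- **The SITEWISE Vasserstein contraction of the tier-2 member** (Föllmer 1988, Ch. I, (2.20), the
coefficient `C_{ik}`): for boundary conditions `ω = η` off ONE link `y`, and every bounded measurable
`L`-Lipschitz (Frobenius) `φ`,
`|∫ φ dγ^W_e(·|ω) - ∫ φ dγ^W_e(·|η)| ≤ (e^{a} √(c v) |β| n(e, y) + e^{a/2} √c ℓ(e, y)) L ‖ω_y - η_y‖_F`,
from the robust one-link lemma (`abs_integral_perturbedOneLink_sub_le`) with the oscillation window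
`a ≥ ∑'_{X ∋ e} osc X e` and the summable cross coefficient `ℓ(e, y) ≥ ∑'_{X ∋ e, y} lip X y`; the
Poincaré (`c`) and linear-variance (`v`) inputs on the ball `‖B‖_op ≤ b ⊇ 2(d-1)|β|` are hypotheses
`hP`, `hVB` exactly as in tier 1. -/
theorem abs_integral_siteLaw_perturbedYMS_sub_le (hd : 1 ≤ d) (hN : 1 ≤ N) {β b c v a : ℝ}
    (hc : 0 ≤ c) (hv : 0 ≤ v) (hb : |β| * (2 * ((d : ℝ) - 1)) ≤ b)
    (hP : ∀ B : Matrix (Fin N) (Fin N) ℂ, matrixOpNorm B ≤ b →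
      ∀ (ψ : Matrix.specialUnitaryGroup (Fin N) ℂ → ℝ) (M : ℝ), 0 ≤ M →
        (∀ x y, |ψ x - ψ y| ≤ M * suFrobDist x y) →
        Var[ψ; (haarProbability (Matrix.specialUnitaryGroup (Fin N) ℂ)).tilted
          fun g => (N : ℝ) * ((g : Matrix (Fin N) (Fin N) ℂ) * B).trace.re] ≤ c * M ^ 2)
    (hVB : ∀ B : Matrix (Fin N) (Fin N) ℂ, matrixOpNorm B ≤ b → ∀ Δ : Matrix (Fin N) (Fin N) ℂ,
      Var[fun g : Matrix.specialUnitaryGroup (Fin N) ℂ =>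
          (N : ℝ) * ((g : Matrix (Fin N) (Fin N) ℂ) * Δ).trace.re;
        (haarProbability (Matrix.specialUnitaryGroup (Fin N) ℂ)).tilted
          fun g => (N : ℝ) * ((g : Matrix (Fin N) (Fin N) ℂ) * B).trace.re] ≤ v * frobNorm Δ ^ 2)
    (h : IsLinkSummable W B) (hWc : ∀ X, Continuous (W X))
    (hWdep : ∀ X, DependsOn (W X) (↑X : Set (ZdEdge d)))
    {osc : Finset (ZdEdge d) → ZdEdge d → ℝ} (hosc : ∀ X, Dobrushin.IsOscBound (W X) (osc X))
    (hoscs : ∀ e, Summable fun X : Finset (ZdEdge d) => (if e ∈ X then osc X e else 0))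
    (hosca : ∀ e, ∑' X : Finset (ZdEdge d), (if e ∈ X then osc X e else 0) ≤ a)
    {lip : Finset (ZdEdge d) → ZdEdge d → ℝ} (hlip : ∀ X, IsLipBound suFrobDist (W X) (lip X))
    {ℓ : ZdEdge d → ZdEdge d → ℝ}
    (hlips : ∀ e y, Summable fun X : Finset (ZdEdge d) => (if e ∈ X ∧ y ∈ X then lip X y else 0))
    (hℓ : ∀ e y, ∑' X : Finset (ZdEdge d), (if e ∈ X ∧ y ∈ X then lip X y else 0) ≤ ℓ e y)
    (e y : ZdEdge d) (ω η : LGConfig d (Matrix.specialUnitaryGroup (Fin N) ℂ))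
    (hωη : ∀ z, z ≠ y → ω z = η z) (φ : Matrix.specialUnitaryGroup (Fin N) ℂ → ℝ) (L : ℝ)
    (hφm : Measurable φ) (hφb : ∃ M, ∀ s, |φ s| ≤ M) (hL : 0 ≤ L)
    (hφL : ∀ x y, |φ x - φ y| ≤ L * suFrobDist x y) :
    |∫ s, φ s ∂(siteLaw (perturbedYMS (fundamentalRep (Fin N)) (N * β) W) e ω) -
        ∫ s, φ s ∂(siteLaw (perturbedYMS (fundamentalRep (Fin N)) (N * β) W) e η)| ≤
      (exp a * Real.sqrt (c * v) * |β| * linkInfluence e y + exp (a / 2) * Real.sqrt c * ℓ e y) * L *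
        suFrobDist (ω y) (η y) := by
  classical
  haveI : SecondCountableTopology (Matrix (Fin N) (Fin N) ℂ) :=
    inferInstanceAs (SecondCountableTopology (Fin N → Fin N → ℂ))
  haveI : SecondCountableTopology (Matrix.specialUnitaryGroup (Fin N) ℂ) :=
    Topology.IsEmbedding.subtypeVal.secondCountableTopology
  have hℓ0 : 0 ≤ ℓ e y := by
    refine le_trans (tsum_nonneg fun X => ?_) (hℓ e y)
    split_ifs
    · exact (hlip X).nonneg y
    · exact le_rfl
  have hr0 : 0 ≤ suFrobDist (ω y) (η y) := suFrobDist_nonneg _ _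
  by_cases hye : y = e
  · subst hye
    have hγ : IsSpecification (perturbedYMS (d := d) (fundamentalRep (Fin N)) (N * β) W) :=
      isSpecification_perturbedYMS _ (continuous_fundamentalRep (Fin N)) _ h hWc hWdep
    rw [siteLaw_congr_of_eq_off' hγ y hωη, sub_self, abs_zero]
    exact mul_nonneg (mul_nonneg (add_nonneg (by positivity) (mul_nonneg (by positivity) hℓ0)) hL) hr0
  rw [siteLaw_perturbedYMS_thooft β h hWc e ω, siteLaw_perturbedYMS_thooft β h hWc e η]
  -- the one-link perturbations at `ω` and `η`: measurable, oscillation `≤ a`, cross difference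
  have hVm : ∀ ζ : LGConfig d (Matrix.specialUnitaryGroup (Fin N) ℂ),
      Measurable fun g : Matrix.specialUnitaryGroup (Fin N) ℂ =>
        ∑' X : Finset (ZdEdge d), (if e ∈ X then W X (Function.update ζ e g) else 0) := fun ζ =>
    (continuous_tsum_through h hWc e).measurable.comp (measurable_update ζ)
  have hoscV : ∀ (ζ : LGConfig d (Matrix.specialUnitaryGroup (Fin N) ℂ))
      (g g' : Matrix.specialUnitaryGroup (Fin N) ℂ),
      (∑' X : Finset (ZdEdge d), (if e ∈ X then W X (Function.update ζ e g) else 0)) ≤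
        (∑' X : Finset (ZdEdge d), (if e ∈ X then W X (Function.update ζ e g') else 0)) + a :=
    fun ζ g g' => tsum_through_update_osc h hosc e (hoscs e) (hosca e) ζ g g'
  obtain ⟨lo, hwinω⟩ := exists_window_of_osc (1 : Matrix.specialUnitaryGroup (Fin N) ℂ) (hoscV ω)
  obtain ⟨lo', hwinη⟩ := exists_window_of_osc (1 : Matrix.specialUnitaryGroup (Fin N) ℂ) (hoscV η)
  have hcross : ∀ g, |(∑' X : Finset (ZdEdge d), (if e ∈ X then W X (Function.update ω e g) else 0)) -
      ∑' X : Finset (ZdEdge d), (if e ∈ X then W X (Function.update η e g) else 0)| ≤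
        ℓ e y * suFrobDist (ω y) (η y) := fun g =>
    (abs_tsum_through_update_sub_le h hWdep hlip hye (hlips e y) hωη g).trans
      (mul_le_mul_of_nonneg_right (hℓ e y) hr0)
  -- the staple fields lie in the ball and differ by `≤ |β| n(e,y) ‖ω_y - η_y‖_F`
  have hBω : matrixOpNorm (stapleField β e ω) ≤ b := (matrixOpNorm_stapleField_le hd hN β e ω).trans hb
  have hBη : matrixOpNorm (stapleField β e η) ≤ b := (matrixOpNorm_stapleField_le hd hN β e η).trans hb
  have hΔB : frobNorm (stapleField β e ω - stapleField β e η) ≤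
      |β| * linkInfluence e y * suFrobDist (ω y) (η y) := frobNorm_stapleField_sub_le β e y hωη
  -- the robust one-link lemma
  have key := abs_integral_perturbedOneLink_sub_le (N := N) hc hv (mul_nonneg hℓ0 hr0) hL hP hVB hBη hBω
    (hVm η) (hVm ω) hwinη hwinω hcross hφm hφb hφL
  refine key.trans ?_
  calc L * (exp a * Real.sqrt (c * v) * frobNorm (stapleField β e ω - stapleField β e η) +
        exp (a / 2) * Real.sqrt c * (ℓ e y * suFrobDist (ω y) (η y)))
      ≤ L * (exp a * Real.sqrt (c * v) * (|β| * linkInfluence e y * suFrobDist (ω y) (η y)) +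
        exp (a / 2) * Real.sqrt c * (ℓ e y * suFrobDist (ω y) (η y))) := by
        gcongr
    _ = (exp a * Real.sqrt (c * v) * |β| * linkInfluence e y + exp (a / 2) * Real.sqrt c * ℓ e y) * L *
          suFrobDist (ω y) (η y) := by ring

/-- **QUASILOCALITY of the one-link law of the tier-2 member** (Föllmer 1988, Ch. I, (2.4): continuity of
`π_k(·|η)` in `η` at infinity): for `ε > 0` and a Lipschitz scale `L` there is a FINITE link set `Λ`
(the plaquette neighbours of `e` and the links of finitely many interaction sets carrying all but a
tail `< δ` of the majorant through `e`) such that boundary conditions agreeing on `Λ` have one-link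
laws at `e` within `ε` on every bounded measurable `L`-Lipschitz `φ` — by the robust one-link lemma
with EQUAL drifts (`re_trace_mul_stapleField_congr`) and the tail estimate
`abs_tsum_through_update_sub_le_tail`. -/
theorem siteLaw_perturbedYMS_quasilocal (hd : 1 ≤ d) (hN : 1 ≤ N) {β b c v a : ℝ}
    (hc : 0 ≤ c) (hv : 0 ≤ v) (hb : |β| * (2 * ((d : ℝ) - 1)) ≤ b)
    (hP : ∀ B : Matrix (Fin N) (Fin N) ℂ, matrixOpNorm B ≤ b →
      ∀ (ψ : Matrix.specialUnitaryGroup (Fin N) ℂ → ℝ) (M : ℝ), 0 ≤ M →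
        (∀ x y, |ψ x - ψ y| ≤ M * suFrobDist x y) →
        Var[ψ; (haarProbability (Matrix.specialUnitaryGroup (Fin N) ℂ)).tilted
          fun g => (N : ℝ) * ((g : Matrix (Fin N) (Fin N) ℂ) * B).trace.re] ≤ c * M ^ 2)
    (hVB : ∀ B : Matrix (Fin N) (Fin N) ℂ, matrixOpNorm B ≤ b → ∀ Δ : Matrix (Fin N) (Fin N) ℂ,
      Var[fun g : Matrix.specialUnitaryGroup (Fin N) ℂ =>
          (N : ℝ) * ((g : Matrix (Fin N) (Fin N) ℂ) * Δ).trace.re;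
        (haarProbability (Matrix.specialUnitaryGroup (Fin N) ℂ)).tilted
          fun g => (N : ℝ) * ((g : Matrix (Fin N) (Fin N) ℂ) * B).trace.re] ≤ v * frobNorm Δ ^ 2)
    (h : IsLinkSummable W B) (hWc : ∀ X, Continuous (W X))
    (hWdep : ∀ X, DependsOn (W X) (↑X : Set (ZdEdge d)))
    {osc : Finset (ZdEdge d) → ZdEdge d → ℝ} (hosc : ∀ X, Dobrushin.IsOscBound (W X) (osc X))
    (hoscs : ∀ e, Summable fun X : Finset (ZdEdge d) => (if e ∈ X then osc X e else 0))
    (hosca : ∀ e, ∑' X : Finset (ZdEdge d), (if e ∈ X then osc X e else 0) ≤ a)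
    (e : ZdEdge d) (M L ε : ℝ) (hε : 0 < ε) :
    ∃ Λ : Finset (ZdEdge d), ∀ (ω η : LGConfig d (Matrix.specialUnitaryGroup (Fin N) ℂ)),
      (∀ z ∈ Λ, ω z = η z) → ∀ (φ : Matrix.specialUnitaryGroup (Fin N) ℂ → ℝ), Measurable φ →
        (∀ s, |φ s| ≤ M) → (∀ x y, |φ x - φ y| ≤ L * suFrobDist x y) →
        |∫ s, φ s ∂(siteLaw (perturbedYMS (fundamentalRep (Fin N)) (N * β) W) e ω) -
            ∫ s, φ s ∂(siteLaw (perturbedYMS (fundamentalRep (Fin N)) (N * β) W) e η)| ≤ ε := by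
  classical
  haveI : SecondCountableTopology (Matrix (Fin N) (Fin N) ℂ) :=
    inferInstanceAs (SecondCountableTopology (Fin N → Fin N → ℂ))
  haveI : SecondCountableTopology (Matrix.specialUnitaryGroup (Fin N) ℂ) :=
    Topology.IsEmbedding.subtypeVal.secondCountableTopology
  -- the Lipschitz scale `L' = max L 0 ≥ 0` and the tail size `δ`
  set L' : ℝ := max L 0 with hL'
  have hL'0 : 0 ≤ L' := le_max_right _ _
  set K : ℝ := L' * (exp (a / 2) * Real.sqrt c) with hK
  have hK0 : 0 ≤ K := by positivity
  have hδ : 0 < ε / (2 * K + 1) := div_pos hε (by positivity)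
  obtain ⟨S, hS⟩ := exists_finset_tail_lt (h.summable e)
    (fun X => by
      split_ifs
      · exact h.nonneg X fun _ => 1
      · exact le_rfl) hδ
  refine ⟨linkPlaqNbr e ∪ S.biUnion id, fun ω η hωη φ hφm hM hφL => ?_⟩
  have hφL' : ∀ x y, |φ x - φ y| ≤ L' * suFrobDist x y := fun x y =>
    (hφL x y).trans (mul_le_mul_of_nonneg_right (le_max_left _ _) (suFrobDist_nonneg _ _))
  rw [siteLaw_perturbedYMS_thooft β h hWc e ω, siteLaw_perturbedYMS_thooft β h hWc e η]
  -- equal drifts: `ω = η` on the plaquette neighbours of `e`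
  have htr : ∀ g : Matrix.specialUnitaryGroup (Fin N) ℂ,
      (N : ℝ) * ((g : Matrix (Fin N) (Fin N) ℂ) * stapleField β e ω).trace.re =
        (N : ℝ) * ((g : Matrix (Fin N) (Fin N) ℂ) * stapleField β e η).trace.re :=
    re_trace_mul_stapleField_congr β e (fun z hz => hωη z (Finset.mem_union_left _ hz))
  have hfun : (fun g : Matrix.specialUnitaryGroup (Fin N) ℂ =>
      (N : ℝ) * ((g : Matrix (Fin N) (Fin N) ℂ) * stapleField β e ω).trace.re -
        ∑' X : Finset (ZdEdge d), (if e ∈ X then W X (Function.update ω e g) else 0)) =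
      fun g : Matrix.specialUnitaryGroup (Fin N) ℂ =>
        (N : ℝ) * ((g : Matrix (Fin N) (Fin N) ℂ) * stapleField β e η).trace.re -
        ∑' X : Finset (ZdEdge d), (if e ∈ X then W X (Function.update ω e g) else 0) :=
    funext fun g => by rw [htr g]
  rw [hfun]
  -- the one-link perturbations: measurable, oscillation `≤ a`, TAIL difference `≤ 2 · tail`
  have hVm : ∀ ζ : LGConfig d (Matrix.specialUnitaryGroup (Fin N) ℂ),
      Measurable fun g : Matrix.specialUnitaryGroup (Fin N) ℂ =>
        ∑' X : Finset (ZdEdge d), (if e ∈ X then W X (Function.update ζ e g) else 0) := fun ζ =>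
    (continuous_tsum_through h hWc e).measurable.comp (measurable_update ζ)
  have hoscV : ∀ (ζ : LGConfig d (Matrix.specialUnitaryGroup (Fin N) ℂ))
      (g g' : Matrix.specialUnitaryGroup (Fin N) ℂ),
      (∑' X : Finset (ZdEdge d), (if e ∈ X then W X (Function.update ζ e g) else 0)) ≤
        (∑' X : Finset (ZdEdge d), (if e ∈ X then W X (Function.update ζ e g') else 0)) + a :=
    fun ζ g g' => tsum_through_update_osc h hosc e (hoscs e) (hosca e) ζ g g'
  obtain ⟨lo, hwinω⟩ := exists_window_of_osc (1 : Matrix.specialUnitaryGroup (Fin N) ℂ) (hoscV ω)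
  obtain ⟨lo', hwinη⟩ := exists_window_of_osc (1 : Matrix.specialUnitaryGroup (Fin N) ℂ) (hoscV η)
  have hΛS : ∀ X ∈ S, ∀ z ∈ X, z ≠ e → z ∈ linkPlaqNbr e ∪ S.biUnion id := fun X hX z hz _ =>
    Finset.mem_union_right _ (Finset.mem_biUnion.2 ⟨X, hX, hz⟩)
  have htail0 : 0 ≤ ∑' X : Finset (ZdEdge d), (if X ∈ S then 0 else (if e ∈ X then B X else 0)) :=
    tsum_nonneg fun X => by
      split_ifs
      · exact le_rfl
      · exact h.nonneg X fun _ => 1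
      · exact le_rfl
  have hcross : ∀ g, |(∑' X : Finset (ZdEdge d), (if e ∈ X then W X (Function.update ω e g) else 0)) -
      ∑' X : Finset (ZdEdge d), (if e ∈ X then W X (Function.update η e g) else 0)| ≤
        2 * ∑' X : Finset (ZdEdge d), (if X ∈ S then 0 else (if e ∈ X then B X else 0)) := fun g =>
    abs_tsum_through_update_sub_le_tail h hWdep e S hΛS hωη g
  have hBη : matrixOpNorm (stapleField β e η) ≤ b := (matrixOpNorm_stapleField_le hd hN β e η).trans hb
  -- the robust one-link lemma with equal drifts
  have key := abs_integral_perturbedOneLink_sub_le (N := N) hc hv (by positivity) hL'0 hP hVB hBη hBη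
    (hVm η) (hVm ω) hwinη hwinω hcross hφm ⟨M, hM⟩ hφL'
  refine key.trans ?_
  rw [sub_self, frobNorm_zero, mul_zero, zero_add]
  have hlt := mul_le_mul_of_nonneg_left hS.le hK0
  calc L' * (exp (a / 2) * Real.sqrt c *
        (2 * ∑' X : Finset (ZdEdge d), (if X ∈ S then 0 else (if e ∈ X then B X else 0))))
      = 2 * (K * ∑' X : Finset (ZdEdge d), (if X ∈ S then 0 else (if e ∈ X then B X else 0))) := by
        rw [hK]; ring
    _ ≤ 2 * (K * (ε / (2 * K + 1))) := by gcongr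
    _ ≤ ε := by
        rw [show 2 * (K * (ε / (2 * K + 1))) = ε * (2 * K / (2 * K + 1)) by ring]
        have h1 : 2 * K / (2 * K + 1) ≤ 1 := (div_le_one (by positivity)).2 (by linarith)
        nlinarith

/-- **The GLOBAL summable Vasserstein bound for the tier-2 member** (Föllmer 1988, Ch. I, (2.20) with
(2.4); lit-1's `global_of_sitewise_of_quasilocal`): for ALL boundary conditions `ω, η`,
`|∫ φ dγ^W_e(·|ω) - ∫ φ dγ^W_e(·|η)| ≤ L ∑'_y C(e, y) ‖ω_y - η_y‖_F` with the summable row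
`C(e, y) = e^{a} √(c v) |β| n(e, y) + e^{a/2} √c ℓ(e, y)` (`ℓ(e, ·)` summable). -/
theorem abs_integral_siteLaw_perturbedYMS_sub_le_tsum (hd : 1 ≤ d) (hN : 1 ≤ N) {β b c v a : ℝ}
    (hc : 0 ≤ c) (hv : 0 ≤ v) (hb : |β| * (2 * ((d : ℝ) - 1)) ≤ b)
    (hP : ∀ B : Matrix (Fin N) (Fin N) ℂ, matrixOpNorm B ≤ b →
      ∀ (ψ : Matrix.specialUnitaryGroup (Fin N) ℂ → ℝ) (M : ℝ), 0 ≤ M →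
        (∀ x y, |ψ x - ψ y| ≤ M * suFrobDist x y) →
        Var[ψ; (haarProbability (Matrix.specialUnitaryGroup (Fin N) ℂ)).tilted
          fun g => (N : ℝ) * ((g : Matrix (Fin N) (Fin N) ℂ) * B).trace.re] ≤ c * M ^ 2)
    (hVB : ∀ B : Matrix (Fin N) (Fin N) ℂ, matrixOpNorm B ≤ b → ∀ Δ : Matrix (Fin N) (Fin N) ℂ,
      Var[fun g : Matrix.specialUnitaryGroup (Fin N) ℂ =>
          (N : ℝ) * ((g : Matrix (Fin N) (Fin N) ℂ) * Δ).trace.re;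
        (haarProbability (Matrix.specialUnitaryGroup (Fin N) ℂ)).tilted
          fun g => (N : ℝ) * ((g : Matrix (Fin N) (Fin N) ℂ) * B).trace.re] ≤ v * frobNorm Δ ^ 2)
    (h : IsLinkSummable W B) (hWc : ∀ X, Continuous (W X))
    (hWdep : ∀ X, DependsOn (W X) (↑X : Set (ZdEdge d)))
    {osc : Finset (ZdEdge d) → ZdEdge d → ℝ} (hosc : ∀ X, Dobrushin.IsOscBound (W X) (osc X))
    (hoscs : ∀ e, Summable fun X : Finset (ZdEdge d) => (if e ∈ X then osc X e else 0))
    (hosca : ∀ e, ∑' X : Finset (ZdEdge d), (if e ∈ X then osc X e else 0) ≤ a)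
    {lip : Finset (ZdEdge d) → ZdEdge d → ℝ} (hlip : ∀ X, IsLipBound suFrobDist (W X) (lip X))
    {ℓ : ZdEdge d → ZdEdge d → ℝ}
    (hlips : ∀ e y, Summable fun X : Finset (ZdEdge d) => (if e ∈ X ∧ y ∈ X then lip X y else 0))
    (hℓ : ∀ e y, ∑' X : Finset (ZdEdge d), (if e ∈ X ∧ y ∈ X then lip X y else 0) ≤ ℓ e y)
    (hℓs : ∀ e, Summable (ℓ e))
    (e : ZdEdge d) (ω η : LGConfig d (Matrix.specialUnitaryGroup (Fin N) ℂ))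
    (φ : Matrix.specialUnitaryGroup (Fin N) ℂ → ℝ) (L : ℝ)
    (hφm : Measurable φ) (hφb : ∃ M, ∀ s, |φ s| ≤ M) (hL : 0 ≤ L)
    (hφL : ∀ x y, |φ x - φ y| ≤ L * suFrobDist x y) :
    |∫ s, φ s ∂(siteLaw (perturbedYMS (fundamentalRep (Fin N)) (N * β) W) e ω) -
        ∫ s, φ s ∂(siteLaw (perturbedYMS (fundamentalRep (Fin N)) (N * β) W) e η)| ≤
      L * ∑' y, (exp a * Real.sqrt (c * v) * |β| * linkInfluence e y + exp (a / 2) * Real.sqrt c * ℓ e y) *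
        suFrobDist (ω y) (η y) := by
  classical
  have hℓ0 : ∀ e y, 0 ≤ ℓ e y := fun e y => by
    refine le_trans (tsum_nonneg fun X => ?_) (hℓ e y)
    split_ifs
    · exact (hlip X).nonneg y
    · exact le_rfl
  have hCs : ∀ x : ZdEdge d, Summable fun y =>
      exp a * Real.sqrt (c * v) * |β| * linkInfluence x y + exp (a / 2) * Real.sqrt c * ℓ x y := by
    intro x
    obtain ⟨hn, -⟩ := summable_linkInfluence_mul hd x (w := fun _ => (1 : ℝ)) (M := 1)
      (fun _ => zero_le_one) (fun _ _ => le_rfl)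
    simp only [mul_one] at hn
    exact (hn.mul_left _).add ((hℓs x).mul_left _)
  exact global_of_sitewise_of_quasilocal (γ := perturbedYMS (fundamentalRep (Fin N)) (N * β) W)
    (fun _ _ => suFrobDist_nonneg _ _) suFrobDist_le
    (fun x y => add_nonneg (by positivity) (mul_nonneg (by positivity) (hℓ0 x y))) hCs e
    (fun y ω η hωη φ L hφm hφb hL hφL => abs_integral_siteLaw_perturbedYMS_sub_le hd hN hc hv hb hP hVB
      h hWc hWdep hosc hoscs hosca hlip hlips hℓ e y ω η hωη φ L hφm hφb hL hφL)
    (fun M L ε hε => siteLaw_perturbedYMS_quasilocal hd hN hc hv hb hP hVB h hWc hWdep hosc hoscs hosca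
      e M L ε hε) ω η φ L hφm hφb hL hφL

end SUN

end Summit.Ventures.YMGap.RobustBall
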